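import Literature.AlgebraicGeometry.Resolution.BlowupRingChartCoordinates
import Mathlib.RingTheory.MvPolynomial.Ideal
import HarnessLib

/-!
# Crux `Steer` (stmt-ResolutionOfSingularities-16345), chain W4.1: hNT4 / Lemma S, part 2 — the CHART MAP of a quadratic
# transform (brick T1 of res-L0-w41-idea-3's `HNT4-BLUEPRINT.md`, reused by the Lemma S kernel of RULING 136a; Theses-free, def-free)

OURS (campaign `res-hironaka`, rung L ★L-G4, slot W4.1; statements about the route's own objects; NOT statements of the
manuscript under review [claim: Hironaka2017, status: under-review]; AI review is weaker than expert review). Seat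
res-D-pv-004 (AS res-L0-w41-stub-10), hNT4 STAGE 2 (res-L0-w41-plan-1 RULING 120c: «T3 + A2 + T1 + lift L = pv-004»).

For regular local subrings `S₀ ≤ S₁` of a field `L` with `S₁ ⊇ S₀[𝔪₀/y₀]` consisting of fractions of the chart ring with
unit denominators (the clauses of `IsQuadraticTransform`), a regular system of parameters `y = (y₀, y₁, …, y_n)` of `S₀`
and an element `x₀ ∈ 𝔪₁` with `𝔪₀·S₁ = (x₀)` (the word's exceptional parameter; `(x₀) = (y₀)` in `S₁`):

* `exists_isUnit_mul_eq_of_span_image_eq` — `x₀ = y₀·u` for a unit `u` of `S₁` (the exceptional parameter is the chart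
  element up to a unit; blueprint pitfall P-a);
* `exists_chartMap` — **T1, the chart map**: there are `t_j = y_j/y₀ ∈ S₁` (`j = 1, …, n`) and a ring homomorphism
  `φ : κ(S₀)[T₁, …, T_n] → S₁ ⧸ (x₀)` with (i) `φ (C s̄) = [s]`, (ii) `φ (T_j) = [t_j]`, (inj) `φ` injective, (frac) every
  class is a fraction `φ a / φ b` with `φ b ∉ 𝔪₁/(x₀)` — i.e. `S₁/(x₀)` is a localisation of the exceptional fibre
  `κ(S₀)[T] ≅ S₀[𝔪₀/y₀]/(y₀)` (`blowupRing_chartQuotient_X`, Stacks 0BIQ) at a prime over the closed point.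

(The RATIONAL-centre consequence `𝔪₁ = (x₀, t₁ − a₁, …, t_n − a_n)` and the Lemma-S coordinates follow in the sequel file.)

No Theses file is imported; nothing here is a route item or a registration. [cite: StacksProject, Tag 0BIQ]
[cite: Cutkosky2014, §2.1]
-/

noncomputable section

-- `Summit.<S>.<S>.…` duplicates the summit name by design (single-problem summit).
set_option linter.dupNamespace false

open IsLocalRing MvPolynomial

namespace Summit.ResolutionOfSingularities.ResolutionOfSingularities.Theorems.SwitchingDichotomy.NoTangentialStep

open Literature.AlgebraicGeometry.Resolution

variable {L : Type} [Field L]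

/-- **The exceptional parameter is the chart element up to a unit** (blueprint P-a): if `S₀ ≤ S₁`, `S₀[𝔪₀/y₀] ≤ S₁` for
some `0 ≠ y₀ ∈ 𝔪₀`, and `𝔪₀·S₁ = (x₀)`, then `x₀ = y₀·u` for a unit `u ∈ S₁`. OURS. [folklore] -/
theorem exists_isUnit_mul_eq_of_span_image_eq {S₀ S₁ : Subring L} [IsLocalRing S₀] (h₀₁ : S₀ ≤ S₁) (y₀ : S₀)
    (hy₀ : y₀ ∈ maximalIdeal S₀) (hy₀0 : y₀ ≠ 0) (hB : blowupRing S₀ (y₀ : L) ≤ S₁) (x₀ : S₁)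
    (hspan : Ideal.span ((fun y : S₀ => (⟨(y : L), h₀₁ y.2⟩ : S₁)) '' (maximalIdeal S₀ : Set S₀)) = Ideal.span {x₀}) :
    ∃ u : S₁, IsUnit u ∧ x₀ = ⟨(y₀ : L), h₀₁ y₀.2⟩ * u := by
  -- `y₀ ∈ (x₀)`: `y₀ = a·x₀`
  have hy₀mem : (⟨(y₀ : L), h₀₁ y₀.2⟩ : S₁) ∈ Ideal.span {x₀} := hspan ▸ Ideal.subset_span ⟨y₀, hy₀, rfl⟩
  obtain ⟨a, ha⟩ := Ideal.mem_span_singleton'.mp hy₀mem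
  -- `x₀ ∈ (y₀)`: every `y ∈ 𝔪₀` is `y₀ · (y/y₀)` with `y/y₀ ∈ S₀[𝔪₀/y₀] ≤ S₁`
  have hle : Ideal.span ((fun y : S₀ => (⟨(y : L), h₀₁ y.2⟩ : S₁)) '' (maximalIdeal S₀ : Set S₀)) ≤
      Ideal.span {(⟨(y₀ : L), h₀₁ y₀.2⟩ : S₁)} := by
    refine Ideal.span_le.mpr ?_
    rintro _ ⟨y, hy, rfl⟩
    refine Ideal.mem_span_singleton'.mpr ⟨⟨(y : L) / (y₀ : L), hB (div_mem_blowupRing _ hy)⟩, Subtype.ext ?_⟩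
    have h0 : ((y₀ : S₀) : L) ≠ 0 := fun h => hy₀0 (Subtype.ext h)
    change (y : L) / (y₀ : L) * (y₀ : L) = (y : L)
    field_simp
  have hx₀mem : x₀ ∈ Ideal.span {(⟨(y₀ : L), h₀₁ y₀.2⟩ : S₁)} := hle (hspan ▸ Ideal.mem_span_singleton_self x₀)
  obtain ⟨b, hb⟩ := Ideal.mem_span_singleton'.mp hx₀mem
  refine ⟨b, ?_, by rw [← hb, mul_comm]⟩
  -- `y₀ = a·x₀ = a·b·y₀`, `y₀ ≠ 0` ⇒ `a·b = 1`
  have h0 : (⟨(y₀ : L), h₀₁ y₀.2⟩ : S₁) ≠ 0 := by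
    intro h
    apply hy₀0
    apply Subtype.ext
    simpa using congrArg Subtype.val h
  have hab : a * b = 1 := by
    have h1 : a * b * (⟨(y₀ : L), h₀₁ y₀.2⟩ : S₁) = 1 * ⟨(y₀ : L), h₀₁ y₀.2⟩ := by
      rw [mul_assoc, hb, ha, one_mul]
    exact mul_right_cancel₀ h0 h1
  exact IsUnit.of_mul_eq_one_right a hab

/-- **T1 — the CHART MAP of a quadratic transform** (res-L0-w41-idea-3 `HNT4-BLUEPRINT.md` §1 T1 / §3): let `S₀ ≤ S₁` be
subrings of a field `L`, `S₀` regular local with regular system of parameters `y = (y₀, …, y_n)`, `y₀ ≠ 0`,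
`S₀[𝔪₀/y₀] ≤ S₁`, every element of `S₁` a fraction `a/b` of elements of `S₀[𝔪₀/y₀]` with `b⁻¹ ∈ S₁`, and `x₀ ∈ 𝔪₁`
with `(x₀) = 𝔪₀·S₁`. Then with `t_j := y_j/y₀ ∈ S₁` (`j = 1, …, n`; so `y_j = y₀·t_j`) there is a ring homomorphism
`φ : κ(S₀)[T₁, …, T_n] → S₁ ⧸ (x₀)` with `φ (C s̄) = [s]` (`s ∈ S₀`), `φ (T_j) = [t_j]`, which is INJECTIVE, and modulo
which every class is a fraction: `z · φ b = φ a` with `φ b ∉ 𝔪₁/(x₀)`. (The exceptional fibre of the chart is the affine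
space `κ(S₀)[T]` — `blowupRing_chartQuotient_X`, Stacks 0BIQ — and `S₁/(x₀)` is its localisation at the centre.)
OURS. [cite: StacksProject, Tag 0BIQ] -/
theorem exists_chartMap {S₀ S₁ : Subring L} [IsLocalRing S₁] (hreg₀ : IsRegularLocalRing S₀) (h₀₁ : S₀ ≤ S₁)
    {n : ℕ} (hd : (maximalIdeal S₀).spanFinrank = n + 1) (y : Fin (n + 1) → S₀)
    (hy : Ideal.span (Set.range y) = maximalIdeal S₀) (hy0 : y 0 ≠ 0) (hB : blowupRing S₀ (y 0 : L) ≤ S₁)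
    (hfr : ∀ z ∈ S₁, ∃ a ∈ blowupRing S₀ (y 0 : L), ∃ b ∈ blowupRing S₀ (y 0 : L), b⁻¹ ∈ S₁ ∧ z = a / b)
    (x₀ : S₁) (hx₀ : x₀ ∈ maximalIdeal S₁)
    (hspan : Ideal.span ((fun y : S₀ => (⟨(y : L), h₀₁ y.2⟩ : S₁)) '' (maximalIdeal S₀ : Set S₀)) = Ideal.span {x₀}) :
    ∃ (t : Fin n → S₁) (φ : MvPolynomial (Fin n) (ResidueField S₀) →+* S₁ ⧸ Ideal.span {x₀}),
      (∀ j : Fin n, (⟨(y j.succ : L), h₀₁ (y j.succ).2⟩ : S₁) = ⟨(y 0 : L), h₀₁ (y 0).2⟩ * t j) ∧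
      (∀ s : S₀, φ (C (residue S₀ s)) = Ideal.Quotient.mk _ ⟨(s : L), h₀₁ s.2⟩) ∧
      (∀ j : Fin n, φ (X j) = Ideal.Quotient.mk _ (t j)) ∧
      Function.Injective φ ∧
      ∀ z : S₁ ⧸ Ideal.span {x₀}, ∃ a b : MvPolynomial (Fin n) (ResidueField S₀),
        φ b ∉ (maximalIdeal S₁).map (Ideal.Quotient.mk (Ideal.span {x₀})) ∧ z * φ b = φ a := by
  classical
  haveI := hreg₀
  have hym : ∀ j, y j ∈ maximalIdeal S₀ := fun j => hy ▸ Ideal.subset_span ⟨j, rfl⟩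
  have hy0L : ((y 0 : S₀) : L) ≠ 0 := fun h => hy0 (Subtype.ext h)
  -- the unit `u` with `x₀ = y₀ u`, and `(x₀) = (y₀)` in `S₁`
  obtain ⟨u, hu, hxu⟩ := exists_isUnit_mul_eq_of_span_image_eq h₀₁ (y 0) (hym 0) hy0 hB x₀ hspan
  set ι : S₀ →+* S₁ := Subring.inclusion h₀₁ with hιdef
  have hι : ∀ s : S₀, ι s = ⟨(s : L), h₀₁ s.2⟩ := fun s => rfl
  set y₀' : S₁ := ⟨(y 0 : L), h₀₁ (y 0).2⟩ with hy₀'def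
  have hIdeal : Ideal.span {x₀} = Ideal.span {y₀'} := by
    apply le_antisymm
    · rw [Ideal.span_singleton_le_iff_mem, Ideal.mem_span_singleton']
      exact ⟨u, by rw [hxu, mul_comm]⟩
    · rw [Ideal.span_singleton_le_iff_mem, ← hspan]
      exact Ideal.subset_span ⟨y 0, hym 0, rfl⟩
  have hy₀'m : y₀' ∈ maximalIdeal S₁ := by
    have : y₀' ∈ Ideal.span {x₀} := hIdeal ▸ Ideal.mem_span_singleton_self _
    obtain ⟨c, hc⟩ := Ideal.mem_span_singleton'.mp this
    rw [← hc]
    exact Ideal.mul_mem_left _ _ hx₀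
  -- the fractions `t_j = y_{j+1}/y₀`
  let t : Fin n → S₁ := fun j => ⟨(y j.succ : L) / (y 0 : L), hB (div_mem_blowupRing _ (hym j.succ))⟩
  have ht : ∀ j : Fin n, (⟨(y j.succ : L), h₀₁ (y j.succ).2⟩ : S₁) = y₀' * t j := by
    intro j
    apply Subtype.ext
    change (y j.succ : L) = (y 0 : L) * ((y j.succ : L) / (y 0 : L))
    field_simp
  -- `Φ : S₀[T] → S₁ → S₁/(x₀)` kills `𝔪₀ S₀[T]`, hence factors through `κ(S₀)[T]`
  let Φ : MvPolynomial (Fin n) S₀ →+* S₁ ⧸ Ideal.span {x₀} :=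
    (Ideal.Quotient.mk (Ideal.span {x₀})).comp (eval₂Hom ι t)
  let σ : MvPolynomial (Fin n) S₀ →+* MvPolynomial (Fin n) (ResidueField S₀) := MvPolynomial.map (residue S₀)
  have hσsurj : Function.Surjective σ := map_surjective _ residue_surjective
  have hσker : RingHom.ker σ = Ideal.map C (maximalIdeal S₀) := by
    change RingHom.ker (MvPolynomial.map (residue S₀)) = _
    rw [MvPolynomial.ker_map, ker_residue]
  have hker : RingHom.ker σ ≤ RingHom.ker Φ := by
    rw [hσker, Ideal.map_le_iff_le_comap]
    intro s hs
    rw [Ideal.mem_comap, RingHom.mem_ker]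
    change Ideal.Quotient.mk (Ideal.span {x₀}) (eval₂Hom ι t (C s)) = 0
    rw [eval₂Hom_C, Ideal.Quotient.eq_zero_iff_mem, ← hspan]
    exact Ideal.subset_span ⟨s, hs, rfl⟩
  let φ : MvPolynomial (Fin n) (ResidueField S₀) →+* S₁ ⧸ Ideal.span {x₀} := σ.liftOfSurjective hσsurj ⟨Φ, hker⟩
  have hφσ : ∀ P, φ (σ P) = Φ P := fun P => σ.liftOfSurjective_comp_apply hσsurj ⟨Φ, hker⟩ P
  have hφC : ∀ s : S₀, φ (C (residue S₀ s)) = Ideal.Quotient.mk _ ⟨(s : L), h₀₁ s.2⟩ := by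
    intro s
    have : σ (C s) = C (residue S₀ s) := map_C _ _
    rw [← this, hφσ]
    change Ideal.Quotient.mk (Ideal.span {x₀}) (eval₂Hom ι t (C s)) = _
    rw [eval₂Hom_C]
    rfl
  have hφX : ∀ j : Fin n, φ (X j) = Ideal.Quotient.mk _ (t j) := by
    intro j
    have : σ (X j) = X j := map_X _ _
    rw [← this, hφσ]
    change Ideal.Quotient.mk (Ideal.span {x₀}) (eval₂Hom ι t (X j)) = _
    rw [eval₂Hom_X']
  -- ### the Literature isomorphism `ψ : κ(S₀)[T_j : j ≠ 0] ≅ B/(y₀)B`, `B = S₀[𝔪₀/y₀]`, and `ι̅ : B/(y₀)B → S₁/(x₀)`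
  obtain ⟨ψ, hψbij, hψC, hψX⟩ := blowupRing_chartQuotient_X S₀ hd y hy 0 hy0
  have hprime := isPrime_span_singleton_blowupRing_of_rsop S₀ hd y hy 0 hy0
  let yB : blowupRing S₀ ((y 0 : S₀) : L) := ⟨((y 0 : S₀) : L), le_blowupRing S₀ ((y 0 : S₀) : L) (y 0).2⟩
  let incl : blowupRing S₀ ((y 0 : S₀) : L) →+* S₁ := Subring.inclusion hB
  have hincl : ∀ b : blowupRing S₀ ((y 0 : S₀) : L), incl b = ⟨(b : L), hB b.2⟩ := fun b => rfl
  have hinclyB : incl yB = y₀' := rfl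
  have hJ : Ideal.span {yB} ≤ (Ideal.span {x₀}).comap incl := by
    rw [Ideal.span_singleton_le_iff_mem, Ideal.mem_comap, hinclyB, hIdeal]
    exact Ideal.mem_span_singleton_self _
  let ιbar : blowupRing S₀ ((y 0 : S₀) : L) ⧸ Ideal.span {yB} →+* S₁ ⧸ Ideal.span {x₀} :=
    Ideal.quotientMap (Ideal.span {x₀}) incl hJ
  have hιbar : ∀ b : blowupRing S₀ ((y 0 : S₀) : L), ιbar (Ideal.Quotient.mk _ b) = Ideal.Quotient.mk _ (incl b) :=
    fun b => Ideal.quotientMap_mk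
  -- reindexing `Fin n ≃ {j : Fin (n+1) // j ≠ 0}`, `j ↦ j.succ`
  let e : Fin n ≃ {j : Fin (n + 1) // j ≠ 0} := finSuccAboveEquiv 0
  have he : ∀ j : Fin n, ((e j : {j : Fin (n + 1) // j ≠ 0}) : Fin (n + 1)) = j.succ := fun j => by
    simp [e, finSuccAboveEquiv_apply]
  let ρ : MvPolynomial (Fin n) (ResidueField S₀) ≃ₐ[ResidueField S₀]
      MvPolynomial {j : Fin (n + 1) // j ≠ 0} (ResidueField S₀) := renameEquiv (ResidueField S₀) e
  -- the square `ι̅ ∘ ψ ∘ ρ = φ`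
  have hsq : (ιbar.comp ψ).comp ρ.toAlgHom.toRingHom = φ := by
    refine MvPolynomial.ringHom_ext (fun c => ?_) (fun j => ?_)
    · obtain ⟨s, rfl⟩ := residue_surjective c
      change ιbar (ψ (ρ (C (residue S₀ s)))) = φ (C (residue S₀ s))
      have hρC : ρ (C (residue S₀ s)) = C (residue S₀ s) := by
        change rename e (C (residue S₀ s)) = _
        exact rename_C _ _
      rw [hρC, hψC, hιbar, hφC]
      rfl
    · change ιbar (ψ (ρ (X j))) = φ (X j)
      have hρX : ρ (X j) = X (e j) := by
        change rename e (X j) = _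
        exact rename_X _ _
      have hmem : ((y (e j : {j : Fin (n + 1) // j ≠ 0}).1 : S₀) : L) / ((y 0 : S₀) : L) ∈
          blowupRing S₀ ((y 0 : S₀) : L) :=
        div_mem_blowupRing _ (hym _)
      rw [hρX, hψX (e j) hmem, hιbar, hφX]
      congr 1
  have hsq' : ∀ P, ιbar (ψ (ρ P)) = φ P := fun P => by rw [← hsq]; rfl
  -- ### `B ∩ (x₀)S₁ = (y₀)B`: a multiple of `y₀` in `S₁` lying in `B` is a multiple of `y₀` in `B`
  have hunitB : ∀ (c : L) (hcB : c ∈ blowupRing S₀ ((y 0 : S₀) : L)), c⁻¹ ∈ S₁ → c ≠ 0 →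
      IsUnit (⟨c, hB hcB⟩ : S₁) := by
    intro c hcB hcinv hc0
    exact IsUnit.of_mul_eq_one (⟨c⁻¹, hcinv⟩ : S₁) (Subtype.ext (mul_inv_cancel₀ hc0))
  have hcontract : ∀ b : blowupRing S₀ ((y 0 : S₀) : L), incl b ∈ Ideal.span {x₀} → b ∈ Ideal.span {yB} := by
    intro b hb
    rw [hIdeal] at hb
    obtain ⟨z, hz⟩ := Ideal.mem_span_singleton'.mp hb
    obtain ⟨a, haB, c, hcB, hcinv, hzac⟩ := hfr (z : L) z.2
    by_cases hc0 : c = 0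
    · -- `z = a/0 = 0`, so `b = 0`
      have hz0 : (z : L) = 0 := by rw [hzac, hc0, div_zero]
      have hb0 : b = 0 := by
        apply Subtype.ext
        have := congrArg Subtype.val hz
        change (z : L) * (y 0 : L) = (b : L) at this
        rw [hz0, zero_mul] at this
        exact this.symm
      rw [hb0]
      exact Ideal.zero_mem _
    · -- `b·c = y₀·a` in `B`, `(y₀)` prime, and `c ∉ (y₀)` since `c` is a unit of `S₁` while `y₀ ∈ 𝔪₁`
      have hbc : b * ⟨c, hcB⟩ = yB * ⟨a, haB⟩ := by
        apply Subtype.ext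
        change (b : L) * c = (y 0 : L) * a
        have := congrArg Subtype.val hz
        change (z : L) * (y 0 : L) = (b : L) at this
        rw [← this, hzac]
        field_simp
      have hmem : b * ⟨c, hcB⟩ ∈ Ideal.span {yB} := by
        rw [hbc]
        exact Ideal.mul_mem_right _ _ (Ideal.mem_span_singleton_self _)
      rcases hprime.mem_or_mem hmem with h | h
      · exact h
      · exfalso
        obtain ⟨c', hc'⟩ := Ideal.mem_span_singleton'.mp h
        have hcm : (⟨c, hB hcB⟩ : S₁) ∈ maximalIdeal S₁ := by
          have : (⟨c, hB hcB⟩ : S₁) = incl c' * y₀' := by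
            rw [← hinclyB, ← map_mul, hc']
            rfl
          rw [this]
          exact Ideal.mul_mem_left _ _ hy₀'m
        exact hcm (hunitB c hcB hcinv hc0)
  -- ### injectivity
  have hφinj : Function.Injective φ := by
    refine (injective_iff_map_eq_zero φ).mpr fun P hP => ?_
    rw [← hsq'] at hP
    obtain ⟨b, hb⟩ := Ideal.Quotient.mk_surjective (ψ (ρ P))
    rw [← hb, hιbar, Ideal.Quotient.eq_zero_iff_mem] at hP
    have hb0 : Ideal.Quotient.mk (Ideal.span {yB}) b = 0 :=
      Ideal.Quotient.eq_zero_iff_mem.mpr (hcontract b hP)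
    have h1 : ψ (ρ P) = 0 := by rw [← hb]; exact hb0
    have hρP : ρ P = 0 := hψbij.1 (by rw [h1, map_zero])
    simpa using congrArg ρ.symm hρP
  -- ### fractions
  have hproper : (maximalIdeal S₁).map (Ideal.Quotient.mk (Ideal.span {x₀})) ≠ ⊤ := by
    intro htop
    have h1 : (1 : S₁ ⧸ Ideal.span {x₀}) ∈ (maximalIdeal S₁).map (Ideal.Quotient.mk (Ideal.span {x₀})) :=
      htop ▸ Submodule.mem_top
    rw [Ideal.mem_map_iff_of_surjective _ Ideal.Quotient.mk_surjective] at h1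
    obtain ⟨m, hm, hm1⟩ := h1
    rw [← map_one (Ideal.Quotient.mk (Ideal.span {x₀})), Ideal.Quotient.eq] at hm1
    have hx1 : m - 1 ∈ maximalIdeal S₁ := by
      obtain ⟨c, hc⟩ := Ideal.mem_span_singleton'.mp hm1
      rw [← hc]
      exact Ideal.mul_mem_left _ _ hx₀
    have : (1 : S₁) ∈ maximalIdeal S₁ := by
      have h := Ideal.sub_mem _ hm hx1
      rwa [sub_sub_cancel] at h
    exact (maximalIdeal.isMaximal S₁).ne_top (Ideal.eq_top_of_isUnit_mem _ this isUnit_one)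
  have hnotmem : ∀ c : S₁, IsUnit c →
      Ideal.Quotient.mk (Ideal.span {x₀}) c ∉ (maximalIdeal S₁).map (Ideal.Quotient.mk (Ideal.span {x₀})) := by
    intro c hc hmem
    exact hproper (Ideal.eq_top_of_isUnit_mem _ hmem (hc.map _))
  refine ⟨t, φ, ht, hφC, hφX, hφinj, fun zbar => ?_⟩
  obtain ⟨z, rfl⟩ := Ideal.Quotient.mk_surjective zbar
  obtain ⟨a, haB, c, hcB, hcinv, hzac⟩ := hfr (z : L) z.2
  by_cases hc0 : c = 0
  · -- `z = 0`: the fraction `0/1`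
    have hz0 : z = 0 := Subtype.ext (by rw [hzac, hc0, div_zero]; rfl)
    refine ⟨0, 1, ?_, ?_⟩
    · rw [map_one, ← map_one (Ideal.Quotient.mk (Ideal.span {x₀}))]
      exact hnotmem 1 isUnit_one
    · rw [hz0, map_zero, map_zero, map_one, mul_one]
  · -- `z = a/c`: polynomials `Pa`, `Pc` over `κ(S₀)` with `φ Pa = [a]`, `φ Pc = [c]`
    obtain ⟨Qa, hQa⟩ := hψbij.2 (Ideal.Quotient.mk _ ⟨a, haB⟩)
    obtain ⟨Qc, hQc⟩ := hψbij.2 (Ideal.Quotient.mk _ ⟨c, hcB⟩)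
    refine ⟨ρ.symm Qa, ρ.symm Qc, ?_, ?_⟩
    · rw [← hsq', AlgEquiv.apply_symm_apply, hQc, hιbar]
      exact hnotmem _ (hunitB c hcB hcinv hc0)
    · rw [← hsq', ← hsq', AlgEquiv.apply_symm_apply, AlgEquiv.apply_symm_apply, hQa, hQc, hιbar, hιbar,
        ← map_mul]
      congr 1
      apply Subtype.ext
      change (z : L) * c = a
      rw [hzac]
      field_simp

end Summit.ResolutionOfSingularities.ResolutionOfSingularities.Theorems.SwitchingDichotomy.NoTangentialStep

end
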